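import Summits.BirchSwinnertonDyer.BirchSwinnertonDyer.Theorems.ClassRecordThreeHsiehDescentOfOpenReciprocity
import Summits.BirchSwinnertonDyer.BirchSwinnertonDyer.Theorems.ClassRecordThreeUnramifiedFixedByOpen
import Summits.BirchSwinnertonDyer.Rank1Residual.X11b.Three.ValueReciprocityDictionary
import HarnessLib

/-!
# Route `ClassRecordThree`, crux `HsiehDescentAtThree` (item stmt-BirchSwinnertonDyer-19108):
# K5-B in its ARCHIMEDEAN shape — the open-subgroup value reciprocity `hVRBU` from
# `Aut(ℂ/F)`-reciprocity of the normalized central values `L(f/K, χ, 1)/(π^{2n+1}·Ω^{4n})`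

Cell `bsd-stepL` (run/shared/lean/pub/bsd-stepL/), seat `bsd-stepL-desc3-p1` (D-0074 hand on item 19108),
`--supports stmt-BirchSwinnertonDyer-19108`.

STATE OF THE ITEM. `Theorems/ClassRecordThreeHsiehDescentOfOpenReciprocity.lean` (bdp g9, p416145) proves
`TateSenCharacterVanishing 3 → (∀ W, hVRBU W) → Theses.ClassRecordThree.HsiehDescentAtThree`, where `hVRBU W` = K5-B in
the OPEN-SUBGROUP shape: for every datum `(ι′, K, 𝔭, κ, f)` an `Ω ≠ 0` and an `m ≥ 1`, `3 ∤ m`, with EXACT reciprocity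
`σ(bdpInterpolationValue 3 f 𝔭 χ n Ω) = bdpInterpolationValue 3 f 𝔭 (^σχ) n Ω` for every `τ ∈ Aut(ℚ̄₃/ℚ₃)` fixing `μ_m`,
every `σ ∈ Aut(ℂ/ℚ)` over `τ` (`σ ∘ ι′ = ι′ ∘ τ`) and every `χ` of the κ-range. That shape still speaks of `ι′`, `τ`,
`κ` and avatars; the printed CM theorems it is to be derived from ([T1] Bertolini–Darmon–Prasanna 2013 Thm. 5.4 ∕ 5.5 ∕
(5.1.16) ∕ Prop. 1.12 (1); Castella–Hsieh 2018 §3) speak of complex `L`-values and `Aut(ℂ/F)` for a NUMBER FIELD `F`.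

WHAT THIS FILE PROVES (glue, unconditional):

* `openValueReciprocity_of_archimedeanReciprocity` — **ARCHIMEDEAN K5-B ⟹ `hVRBU W`**, where ARCHIMEDEAN K5-B for `W`
  is: for every `(K, N, f)` with `IsNewformOf W f`, `W.conductorNorm ℤ = N`, `K` imaginary quadratic,
  `SatisfiesHeegnerHypothesis N K`, `3` split in `K`: `∃ Ω ≠ 0`, `∃ F : IntermediateField ℚ ℂ` finite over `ℚ` with
  every prime of `𝓞 F` above `3` of ramification index `1`, such that for every `σ ∈ Aut(ℂ/F)` and every
  everywhere-unramified `χ` of infinity type `(n, −n)`, `n ≥ 1`: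
  `σ(L(f/K,χ,1)/(π^{2n+1}Ω^{4n})) = L(f/K,^σχ,1)/(π^{2n+1}Ω^{4n})`. PROOF: T6-OPEN
  (`UnramifiedOpen.exists_level_forall_fixing_rootsOfUnity_apply_symm_eq`, p418539): `F` unramified above `3` gives
  `m` with `3 ∤ m` such that every `τ` fixing `μ_m` fixes `ι′⁻¹(F)`, hence `σ = ι′τι′⁻¹` fixes `F`; then x11b3-p1's
  DICTIONARY (`Three.bdpInterpolationValue_exact_of_normalizedValue_exact`, `a_p ∈ ℤ` from `IsNewformOf`) transports
  exactness from the normalized central value to `bdpInterpolationValue`. The κ-range restriction and the clause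
  «𝔭 induced by ι′» of `hVRBU` are not needed (the archimedean statement is for ALL unramified `χ` of type `(n, −n)`).
* `hsiehDescentAt₃_of_archimedeanReciprocity_of_tateSenCharacter` — `TateSenCharacterVanishing 3 →` ARCHIMEDEAN K5-B
  for `W` `→ Three.HsiehDescentAt₃ W` (composition with K4⁗′).
* `classRecordThree_hsiehDescentAtThree_of_tateSenCharacter_of_archimedeanReciprocity` — the route item
  `Theses.ClassRecordThree.HsiehDescentAtThree` from `TateSenCharacterVanishing 3` and ARCHIMEDEAN K5-B for every `W`.

EFFECT: item 19108's one non-fact hypothesis is now a statement about COMPLEX central `L`-values under `Aut(ℂ/F)`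
only — the currency in which [T1] is printed (BDP13 Thm. 5.5: «`L_alg(f, χ⁻¹, 0)` belongs to `F`», proof: (5.1.16)
`L_alg = (Σ_{[𝔞]} χ_j⁻¹(𝔞)·Θ^j_Hodge f(𝔞⋆(A₀,t₀,ω₀)))²` with the CM values in the Hilbert class field by Prop. 1.12
(1) and the diamond rule (4.1.3)). HONEST FRAMING: CONDITIONAL glue; ARCHIMEDEAN K5-B is NOT discharged here (it is
filed separately as a Literature named fact, print-derived, review-queued); the node `Three.HsiehDescentAt₃`, K4″ and
K4⁗′ are untouched; the item stays OPEN; nothing booked (T7). What this is NOT: not K5-B; not a statement at `p ≥ 5`.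

References: [BertoliniDarmonPrasanna2013] §4.1 (4.1.3), Thm. 4.6, §5.1 (5.1.11), Lemma 5.3, Thm. 5.4, (5.1.15),
Thm. 5.5, (5.1.16), Prop. 1.12 (1) (author version pp. 14, 34–38, 58–60; held `paper:url-39cfb2a03b1d`);
[CastellaHsieh2018] §2.5, §3.3, Prop. 3.4 ∕ 3.6; [Castella2018] Thm. 3.1; [Weil1956] §1; cell files PROOF-BDP §18, x11b3
LIT-TABLE L72 ∕ L90.
-/

noncomputable section

open scoped NumberField
open NumberField IsDedekindDomain Field WeierstrassCurve
open Literature.NumberTheory.GaloisRepresentations Literature.NumberTheory.EllipticCurves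
open Literature.NumberTheory.EllipticCurves.ModularForms
open Summit.BirchSwinnertonDyer.Rank1Residual Summit.BirchSwinnertonDyer.Rank1Residual.X11b
open Summit.BirchSwinnertonDyer.Rank1Residual.X11b.Three
open Literature.NumberTheory.PAdicHodge (TateSenCharacterVanishing)

namespace Summit.BirchSwinnertonDyer.BirchSwinnertonDyer.Theorems

variable (W : WeierstrassCurve ℚ) [W.IsElliptic]

omit [W.IsElliptic] in
/-- **ARCHIMEDEAN K5-B ⟹ the open-subgroup value reciprocity `hVRBU W` of p416145.** Hypothesis (ARCHIMEDEAN K5-B for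
`W`): for every imaginary quadratic `K` with the Heegner hypothesis for the level `N = N_W` of the newform `f` of `W`
and `3` split in `K`, there are `Ω ≠ 0` and a subfield `F ⊂ ℂ` finite over `ℚ`, unramified above `3`, such that every
`σ ∈ Aut(ℂ/F)` is EXACT on the normalized central values: `σ(L(f/K,χ,1)/(π^{2n+1}Ω^{4n})) =
L(f/K,^σχ,1)/(π^{2n+1}Ω^{4n})` for all everywhere-unramified `χ` of type `(n,−n)`, `n ≥ 1`. Conclusion: the binder
`hVRBU W` of `hsiehDescentAt₃_of_openValueReciprocity_of_tateSenCharacter` VERBATIM. Proof: T6-OPEN gives `m`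
(`3 ∤ m`) with every `τ` fixing `μ_m` fixing `ι′⁻¹(F)`, so `σ` over `τ` fixes `F`; the dictionary
`Three.bdpInterpolationValue_exact_of_normalizedValue_exact` (elementary factor `Γ(n)Γ(n+1)·E_𝔭(χ)²` termwise
equivariant, `a_p ∈ ℤ`) does the rest. Unconditional glue; nothing discharged.
[cite: BertoliniDarmonPrasanna2013, Thm. 5.5 and (5.1.16) (p. 60)] [cite: Castella2018, Thm. 3.1 (arXiv:1704.06608 p. 9)]
[cite: SerreLocalFields1979, Ch. IV §4 Prop. 16 and Cor. 1] -/
theorem openValueReciprocity_of_archimedeanReciprocity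
    (hArch : ∀ (K : Type) [Field K] [NumberField K] {N : ℕ} [NeZero N]
      (f : CuspForm (CongruenceSubgroup.Gamma0 N) 2),
      IsNewformOf W f → W.conductorNorm ℤ = N → IsImaginaryQuadratic K → SatisfiesHeegnerHypothesis N K →
      ((Ideal.span {(3 : ℤ)}).primesOver (𝓞 K)).ncard = 2 →
      ∃ Ω : ℂ, Ω ≠ 0 ∧ ∃ F : IntermediateField ℚ ℂ, FiniteDimensional ℚ F ∧
        (∀ P : Ideal (𝓞 F), P.IsPrime → ((3 : ℕ) : 𝓞 F) ∈ P → P.ramificationIdx (𝓞 ℚ) = 1) ∧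
        ∀ σ : ℂ ≃ₐ[ℚ] ℂ, (∀ x : ℂ, x ∈ F → σ x = x) →
          ∀ (χ : HeckeCharacter K) (n : ℕ), 0 < n →
            (∀ v : HeightOneSpectrum (𝓞 K), χ.IsUnramifiedAt v) →
            ∀ hχ : χ.HasInfinityType (fun _ ↦ (n : ℤ)) (fun _ ↦ -(n : ℤ)),
              σ (rankinSelbergValueHecke f χ 1 / ((Real.pi : ℂ) ^ (2 * n + 1) * Ω ^ (4 * n))) =
                rankinSelbergValueHecke f (hχ.autConj σ) 1 / ((Real.pi : ℂ) ^ (2 * n + 1) * Ω ^ (4 * n))) :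
  ∀ (ι' : PadicAlgCl 3 ≃+* ℂ) (K : Type) [Field K] [NumberField K] (𝔭 : HeightOneSpectrum (𝓞 K))
      (κ : ZpExtension K 3) {N : ℕ} [NeZero N] (f : CuspForm (CongruenceSubgroup.Gamma0 N) 2),
      IsNewformOf W f → W.conductorNorm ℤ = N → IsImaginaryQuadratic K → SatisfiesHeegnerHypothesis N K →
      ((Ideal.span {(3 : ℤ)}).primesOver (𝓞 K)).ncard = 2 → ((3 : ℕ) : 𝓞 K) ∈ 𝔭.asIdeal →
      𝔭.asIdeal.ramificationIdx (𝓞 ℚ) = 1 → 𝔭.asIdeal.inertiaDeg (𝓞 ℚ) = 1 →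
      (∀ (w : InfinitePlace K) (k : 𝓞 K), k ∈ 𝔭.asIdeal ↔ ‖ι'.symm (w.embedding (k : K))‖ < 1) →
      κ.IsAnticyclotomic →
      ∃ Ω : ℂ, Ω ≠ 0 ∧ ∃ m : ℕ, 0 < m ∧ ¬ 3 ∣ m ∧
        (∀ (τ : PadicAlgCl 3 ≃ₐ[ℚ_[3]] PadicAlgCl 3) (σ : ℂ ≃ₐ[ℚ] ℂ),
          (∀ ζ : PadicAlgCl 3, ζ ^ m = 1 → τ ζ = ζ) →
          (∀ z : PadicAlgCl 3, σ (ι' z) = ι' (τ z)) →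
          ∀ (χ : HeckeCharacter K) (n : ℕ), 0 < n →
            (∀ v : HeightOneSpectrum (𝓞 K), χ.IsUnramifiedAt v) →
            ∀ hχ : χ.HasInfinityType (fun _ ↦ (n : ℤ)) (fun _ ↦ -(n : ℤ)),
              ∀ r : FramedGaloisRep K (PadicAlgCl 3) 1, IsPAdicAvatarOf ι' χ r → FactorsThroughZp κ r →
                σ (bdpInterpolationValue 3 f 𝔭 χ n Ω) =
                  bdpInterpolationValue 3 f 𝔭 (hχ.autConj σ) n Ω) := by
  intro ι' K _ _ 𝔭 κ N _ f hf hN hKiq hHeeg hsplit _ _ _ _ _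
  haveI : Fact (Nat.Prime 3) := ⟨Nat.prime_three⟩
  obtain ⟨Ω, hΩ, F, hFd, hunr, hexact⟩ := hArch K f hf hN hKiq hHeeg hsplit
  obtain ⟨m, hm, h3m, hfix⟩ :=
    UnramifiedOpen.exists_level_forall_fixing_rootsOfUnity_apply_symm_eq 3 ι' F hFd hunr
  refine ⟨Ω, hΩ, m, hm, h3m, fun τ σ hτ hστ χ n hn hunrχ hχ _ _ _ ↦ ?_⟩
  have hσF : ∀ x : ℂ, x ∈ F → σ x = x := fun x hx ↦ by
    have h := hστ (ι'.symm x)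
    rwa [ι'.apply_symm_apply, hfix τ hτ x hx, ι'.apply_symm_apply] at h
  exact bdpInterpolationValue_exact_of_normalizedValue_exact 3 (exists_int_cuspCoeff_eq_of_isNewformOf hf 3) 𝔭 hχ
    n Ω σ (hexact σ hσF χ n hn hunrχ hχ)

/-- **`Three.HsiehDescentAt₃ W` from the printed Tate–Sen theorem and ARCHIMEDEAN K5-B** — K4⁗′
(`hsiehDescentAt₃_of_openValueReciprocity_of_tateSenCharacter`, bdp g9) composed with
`openValueReciprocity_of_archimedeanReciprocity`. CONDITIONAL on the named fact `TateSenCharacterVanishing 3`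
(Brinon–Conrad Thm. 2.2.7) and on ARCHIMEDEAN K5-B (print-derived from BDP13 Thm. 5.5 ∕ (5.1.16) ∕ Prop. 1.12 (1),
NOT discharged here); the node `Three.HsiehDescentAt₃` is untouched; nothing booked.
[cite: BertoliniDarmonPrasanna2013, Thm. 5.5 and (5.1.16) (p. 60)] [cite: BrinonConrad2009, Thm. 2.2.7]
[cite: Hsieh2014, Thm. 1 (arXiv:1112.1580 pp. 3–4)] -/
theorem hsiehDescentAt₃_of_archimedeanReciprocity_of_tateSenCharacter
    (hTS : TateSenCharacterVanishing 3)
    (hArch : ∀ (K : Type) [Field K] [NumberField K] {N : ℕ} [NeZero N]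
      (f : CuspForm (CongruenceSubgroup.Gamma0 N) 2),
      IsNewformOf W f → W.conductorNorm ℤ = N → IsImaginaryQuadratic K → SatisfiesHeegnerHypothesis N K →
      ((Ideal.span {(3 : ℤ)}).primesOver (𝓞 K)).ncard = 2 →
      ∃ Ω : ℂ, Ω ≠ 0 ∧ ∃ F : IntermediateField ℚ ℂ, FiniteDimensional ℚ F ∧
        (∀ P : Ideal (𝓞 F), P.IsPrime → ((3 : ℕ) : 𝓞 F) ∈ P → P.ramificationIdx (𝓞 ℚ) = 1) ∧
        ∀ σ : ℂ ≃ₐ[ℚ] ℂ, (∀ x : ℂ, x ∈ F → σ x = x) →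
          ∀ (χ : HeckeCharacter K) (n : ℕ), 0 < n →
            (∀ v : HeightOneSpectrum (𝓞 K), χ.IsUnramifiedAt v) →
            ∀ hχ : χ.HasInfinityType (fun _ ↦ (n : ℤ)) (fun _ ↦ -(n : ℤ)),
              σ (rankinSelbergValueHecke f χ 1 / ((Real.pi : ℂ) ^ (2 * n + 1) * Ω ^ (4 * n))) =
                rankinSelbergValueHecke f (hχ.autConj σ) 1 / ((Real.pi : ℂ) ^ (2 * n + 1) * Ω ^ (4 * n))) :
    HsiehDescentAt₃ W :=
  hsiehDescentAt₃_of_openValueReciprocity_of_tateSenCharacter W hTS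
    (openValueReciprocity_of_archimedeanReciprocity W hArch)

/-- **Item `stmt-BirchSwinnertonDyer-19108` (crux `HsiehDescentAtThree` of route `ClassRecordThree`) CONDITIONALLY, with
the K5-B hypothesis in its ARCHIMEDEAN shape**: `Theses.ClassRecordThree.HsiehDescentAtThree` (both loci, indeed every
elliptic `W`) from (i) the named fact `TateSenCharacterVanishing 3` and (ii) ARCHIMEDEAN K5-B for every `W` —
`Aut(ℂ/F)`-exactness of the normalized central values `L(f/K,χ,1)/(π^{2n+1}Ω^{4n})` for some `Ω ≠ 0` and some number
field `F ⊂ ℂ` unramified above `3` (print-derived from BDP13 Thm. 5.5 ∕ (5.1.16) ∕ Prop. 1.12 (1): `L_alg` is the square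
of a sum of `χ_j⁻¹(𝔞)` times CM values lying in the Hilbert class field; a HYPOTHESIS here, filed separately as a
Literature named fact). The item is NOT closed by this theorem (conditional-result); nothing booked (T7).
[cite: BertoliniDarmonPrasanna2013, Thm. 5.5 and (5.1.16) (p. 60)] [cite: BrinonConrad2009, Thm. 2.2.7] -/
theorem classRecordThree_hsiehDescentAtThree_of_tateSenCharacter_of_archimedeanReciprocity
    (hTS : TateSenCharacterVanishing 3)
    (hArch : ∀ (W : WeierstrassCurve ℚ) [W.IsElliptic] (K : Type) [Field K] [NumberField K] {N : ℕ} [NeZero N]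
      (f : CuspForm (CongruenceSubgroup.Gamma0 N) 2),
      IsNewformOf W f → W.conductorNorm ℤ = N → IsImaginaryQuadratic K → SatisfiesHeegnerHypothesis N K →
      ((Ideal.span {(3 : ℤ)}).primesOver (𝓞 K)).ncard = 2 →
      ∃ Ω : ℂ, Ω ≠ 0 ∧ ∃ F : IntermediateField ℚ ℂ, FiniteDimensional ℚ F ∧
        (∀ P : Ideal (𝓞 F), P.IsPrime → ((3 : ℕ) : 𝓞 F) ∈ P → P.ramificationIdx (𝓞 ℚ) = 1) ∧
        ∀ σ : ℂ ≃ₐ[ℚ] ℂ, (∀ x : ℂ, x ∈ F → σ x = x) →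
          ∀ (χ : HeckeCharacter K) (n : ℕ), 0 < n →
            (∀ v : HeightOneSpectrum (𝓞 K), χ.IsUnramifiedAt v) →
            ∀ hχ : χ.HasInfinityType (fun _ ↦ (n : ℤ)) (fun _ ↦ -(n : ℤ)),
              σ (rankinSelbergValueHecke f χ 1 / ((Real.pi : ℂ) ^ (2 * n + 1) * Ω ^ (4 * n))) =
                rankinSelbergValueHecke f (hχ.autConj σ) 1 / ((Real.pi : ℂ) ^ (2 * n + 1) * Ω ^ (4 * n))) :
    Summit.BirchSwinnertonDyer.BirchSwinnertonDyer.Theses.ClassRecordThree.HsiehDescentAtThree := by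
  intro W _ _ _
  exact ⟨fun _ _ ↦ hsiehDescentAt₃_of_archimedeanReciprocity_of_tateSenCharacter W hTS (hArch W),
    fun _ _ ↦ hsiehDescentAt₃_of_archimedeanReciprocity_of_tateSenCharacter W hTS (hArch W)⟩

end Summit.BirchSwinnertonDyer.BirchSwinnertonDyer.Theorems

end
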